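import Literature.Computability.AlgebraicComplexity.MS21ANFFirstDerivativeHitting
import Literature.Computability.AlgebraicComplexity.MS21MultilinearIrreducibility
import Literature.Computability.AlgebraicComplexity.MS21DiagonalTensorHasseSeparation
import Literature.Computability.AlgebraicComplexity.MS21SparseOrbitHittingProofs
import Literature.Computability.AlgebraicComplexity.MS21ANFSecondDerivativeHitting
import Literature.Barriers.ValiantsHypothesis.ShiftedPartialsDegenerations
import HarnessLib

/-!
# Medini–Shpilka 2021, Lemma 5.12 (roanfMonInc) — block support calculus for the induction step

Theorem-only support file (cell `val-lit`, seat p1 g5; brick "5.12b" for the registry fact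
`MS2021_thm_35`, owner seat x5 g3) for [MediniShpilka2021, Lemma 5.12, arXiv:2102.05632
p0027:L40–L43, printed proof p0027:L44–p0028:L40]:

> "Let `g(x) = ANF_Δ(Ax + b)` … If `mon(g) ⊆ mon(ANF_Δ(x))`, then `b = 0` and
> `mon(q_i(Ax)) = mon(q_i(x))`, up to `TR` symmetry. In particular `mon(g) = mon(ANF_Δ(x))`."

The induction step `Δ + 1 → Δ + 2` is written on the product index type `Fin 4 × τ` (block `b`,
position `j`), for the block polynomial `B = A⁽⁰⁾A⁽¹⁾ + A⁽²⁾A⁽³⁾` of an abstract multilinear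
homogeneous `A` (later `A = ANF_{Δ+1}`), so that the four blocks are literal.  This file: support of
a product of variable-disjoint polynomials (no cancellation); multilinear products have
variable-disjoint factors; the linear substitution `q ↦ q(Mx)` as an algebra automorphism
(irreducibility transport); the shape of the monomials of `B`; and the first dichotomy of the
printed proof — every column of `M` lives on ONE side of the top addition gate (irreducibility of
`∂g/∂x_i` by Obs. 2.7 against "every monomial of `∂g/∂x_i` is divisible by the sibling `x_j`",
p0028:L13–L19).  No definitions, no named facts; nothing here bears on `VP ≠ VNP`.

## References
* [MediniShpilka2021] D. Medini, A. Shpilka, *Hitting sets and reconstruction for dense orbits in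
  VP_e and ΣΠΣ circuits*, arXiv:2102.05632 (CCC 2021), Lemma 5.12 and Obs. 2.7, 5.7, 5.8, Cor. 5.10.
-/

noncomputable section

open MvPolynomial Finset Matrix

namespace Literature.Computability.AlgebraicComplexity

namespace MS2021

/-! ### Generic support calculus -/

section Generic

variable {K : Type*} [Field K] {σ : Type*}

/-- The variables of a monomial of `p` are variables of `p`. [folklore] -/
private theorem support_subset_vars [DecidableEq σ] {p : MvPolynomial σ K} {m : σ →₀ ℕ}
    (hm : m ∈ p.support) : m.support ⊆ p.vars := fun i hi =>
  (mem_vars_iff_mem_support i).2 ⟨m, hm, hi⟩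

/-- **No cancellation across disjoint variable sets**: if `p` only involves variables of `S` and
`q` only variables outside `S`, the coefficient of `μ + ν` (`μ` inside, `ν` outside `S`) in `p·q`
is `coeff μ p · coeff ν q`. [cite: MediniShpilka2021, proof of Lemma 5.12 (arXiv p0028:L20-L24), book-keeping] -/
theorem coeff_add_mul_of_vars_subset [DecidableEq σ] {p q : MvPolynomial σ K} {S : Finset σ}
    (hp : p.vars ⊆ S) (hq : ∀ i ∈ q.vars, i ∉ S) {μ ν : σ →₀ ℕ} (hμ : μ.support ⊆ S)
    (hν : ∀ i ∈ ν.support, i ∉ S) : coeff (μ + ν) (p * q) = coeff μ p * coeff ν q := by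
  rw [coeff_mul]
  apply Finset.sum_eq_single (μ, ν)
  · rintro ⟨a, c⟩ hac hne
    simp only [Finset.HasAntidiagonal.mem_antidiagonal] at hac
    by_contra h
    obtain ⟨ha, hc⟩ := ne_zero_and_ne_zero_of_mul h
    have haS : a.support ⊆ S := (support_subset_vars (mem_support_iff.2 ha)).trans hp
    have hcS : ∀ i ∈ c.support, i ∉ S :=
      fun i hi => hq i (support_subset_vars (mem_support_iff.2 hc) hi)
    have key : ∀ i, a i = μ i := by
      intro i
      have h1 : a i + c i = μ i + ν i := by
        have := congrArg (fun f : σ →₀ ℕ => f i) hac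
        simpa only [Finsupp.coe_add, Pi.add_apply] using this
      by_cases hi : i ∈ S
      · have h2 : c i = 0 := Finsupp.notMem_support_iff.1 fun h => hcS i h hi
        have h3 : ν i = 0 := Finsupp.notMem_support_iff.1 fun h => hν i h hi
        rw [h2, h3] at h1
        simpa using h1
      · have h2 : a i = 0 := Finsupp.notMem_support_iff.1 fun h => hi (haS h)
        have h3 : μ i = 0 := Finsupp.notMem_support_iff.1 fun h => hi (hμ h)
        rw [h2, h3]
    have hac' : a = μ := Finsupp.ext key
    subst hac'
    exact hne (Prod.ext rfl (add_left_cancel hac))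
  · intro h
    exfalso
    apply h
    simp only [Finset.HasAntidiagonal.mem_antidiagonal]

/-- Under the same hypotheses the support of `p·q` is exactly `{μ + ν}`.
[cite: MediniShpilka2021, proof of Lemma 5.12 (arXiv p0028:L20-L24), book-keeping] -/
theorem mem_support_mul_iff_of_vars_subset [DecidableEq σ] {p q : MvPolynomial σ K} {S : Finset σ}
    (hp : p.vars ⊆ S) (hq : ∀ i ∈ q.vars, i ∉ S) (m : σ →₀ ℕ) :
    m ∈ (p * q).support ↔ ∃ μ ∈ p.support, ∃ ν ∈ q.support, m = μ + ν := by
  constructor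
  · intro hm
    obtain ⟨μ, hμ, ν, hν, h⟩ := Finset.mem_add.1 (support_mul p q hm)
    exact ⟨μ, hμ, ν, hν, h.symm⟩
  · rintro ⟨μ, hμ, ν, hν, rfl⟩
    rw [mem_support_iff, coeff_add_mul_of_vars_subset hp hq ((support_subset_vars hμ).trans hp)
      (fun i hi => hq i (support_subset_vars hν hi))]
    exact mul_ne_zero (mem_support_iff.1 hμ) (mem_support_iff.1 hν)

/-- **Multilinear products have variable-disjoint factors** ("as all monomials of `g₁g₂` are
multilinear, `var(g₁) ∩ var(g₂) = ∅`"). [cite: MediniShpilka2021, proof of Lemma 5.12 (arXiv p0028:L27)] -/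
theorem disjoint_vars_of_degreeOf_mul_le_one {p q : MvPolynomial σ K} (hp : p ≠ 0) (hq : q ≠ 0)
    (h : ∀ i, degreeOf i (p * q) ≤ 1) : Disjoint p.vars q.vars := by
  classical
  rw [Finset.disjoint_left]
  intro i hip hiq
  rw [mem_vars_iff_degreeOf_ne_zero] at hip hiq
  have := h i
  rw [degreeOf_mul_eq hp hq] at this
  omega

/-- A polynomial all of whose monomials have degree `≤ 1` in each variable is multilinear.
[cite: MediniShpilka2021, proof of Lemma 5.12 (arXiv p0028:L7-L40), book-keeping] -/
theorem degreeOf_le_one_of_support {p : MvPolynomial σ K} (h : ∀ m ∈ p.support, ∀ i, m i ≤ 1)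
    (i : σ) : degreeOf i p ≤ 1 := by
  classical
  rw [degreeOf_eq_sup]
  exact Finset.sup_le fun m hm => h m hm i

/-- A nonzero homogeneous polynomial of positive degree involves a variable. [cite: MediniShpilka2021, proof of Lemma 5.12 (arXiv p0028:L7-L40), book-keeping] -/
theorem vars_nonempty_of_isHomogeneous [DecidableEq σ] {p : MvPolynomial σ K} {n : ℕ}
    (hp : p.IsHomogeneous n) (hn : n ≠ 0) (h0 : p ≠ 0) : p.vars.Nonempty := by
  obtain ⟨m, hm⟩ := exists_coeff_ne_zero h0
  have hm0 : m ≠ 0 := by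
    rintro rfl
    refine hm (hp.coeff_eq_zero ?_)
    rw [map_zero]
    exact hn.symm
  obtain ⟨i, hi⟩ := Finsupp.ne_iff.1 hm0
  exact ⟨i, (mem_vars_iff_mem_support i).2 ⟨m, mem_support_iff.2 hm, Finsupp.mem_support_iff.2 hi⟩⟩

/-- Partial derivatives do not raise the degree in any variable. [cite: MediniShpilka2021, proof of Lemma 5.12 (arXiv p0028:L7-L40), book-keeping] -/
theorem degreeOf_pderiv_le (i j : σ) (p : MvPolynomial σ K) :
    degreeOf i (pderiv j p) ≤ degreeOf i p := by
  classical
  rw [degreeOf_le_iff]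
  intro m hm
  obtain ⟨α, hα, rfl⟩ := Finset.mem_image.1 (support_pderiv_subset p j hm)
  exact le_trans (by simp only [Finsupp.coe_tsub, Pi.sub_apply]; omega)
    (monomial_le_degreeOf i (Finset.mem_filter.1 hα).1)

/-- A linear combination of partial derivatives of a multilinear polynomial is multilinear and
involves only its variables. [cite: MediniShpilka2021, proof of Lemma 5.12 (arXiv p0028:L7-L40), book-keeping] -/
theorem degreeOf_sum_C_mul_pderiv_le [Fintype σ] (u : σ → K) {p : MvPolynomial σ K}
    (hp : ∀ i, degreeOf i p ≤ 1) (i : σ) : degreeOf i (∑ v, C (u v) * pderiv v p) ≤ 1 := by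
  classical
  refine (degreeOf_sum_le i _ _).trans (Finset.sup_le fun v _ => ?_)
  exact (degreeOf_C_mul_le _ _ _).trans ((degreeOf_pderiv_le i v p).trans (hp i))

/-- Variables of a linear combination of partial derivatives. [cite: MediniShpilka2021, proof of Lemma 5.12 (arXiv p0028:L7-L40), book-keeping] -/
theorem vars_sum_C_mul_pderiv_subset [Fintype σ] [DecidableEq σ] (u : σ → K)
    (p : MvPolynomial σ K) : (∑ v, C (u v) * pderiv v p).vars ⊆ p.vars := by
  intro j hj
  obtain ⟨v, -, hv⟩ := Finset.mem_biUnion.1 (vars_sum_subset _ _ hj)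
  rcases Finset.mem_union.1 (vars_mul _ _ hv) with h | h
  · rw [vars_C] at h
    exact absurd h (Finset.notMem_empty _)
  · exact Literature.Barriers.ValiantsHypothesis.vars_pderiv_subset v p h

/-- A partial derivative in a variable outside the range of a renaming vanishes. [cite: MediniShpilka2021, proof of Lemma 5.12 (arXiv p0028:L7-L40), book-keeping] -/
theorem pderiv_rename_of_notMem_range {ι : Type*} [DecidableEq σ] (f : ι → σ) {y : σ}
    (hy : y ∉ Set.range f) (p : MvPolynomial ι K) : pderiv y (rename f p) = 0 := by
  apply pderiv_eq_zero_of_notMem_vars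
  intro h
  obtain ⟨i, -, rfl⟩ := Finset.mem_image.1 (vars_rename f p h)
  exact hy ⟨i, rfl⟩

end Generic

/-! ### The linear substitution `q ↦ q(Mx)` as an automorphism -/

section LinSubst

variable {K : Type*} [Field K] {σ : Type*} [Fintype σ] [DecidableEq σ]

/-- The identity matrix substitutes trivially. [cite: MediniShpilka2021, proof of Lemma 5.12 (arXiv p0028:L7-L40), book-keeping] -/
theorem aeval_linSubst_one :
    (aeval (fun v : σ => ∑ w, C ((1 : Matrix σ σ K) v w) * X w) :
      MvPolynomial σ K →ₐ[K] MvPolynomial σ K) = AlgHom.id K _ := by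
  refine MvPolynomial.algHom_ext fun v => ?_
  rw [aeval_X, AlgHom.id_apply, Finset.sum_eq_single v (fun w _ hw => by
      rw [Matrix.one_apply_ne (Ne.symm hw), C_0, zero_mul]) (fun h => absurd (Finset.mem_univ v) h),
    Matrix.one_apply_eq, C_1, one_mul]

/-- **`q ↦ q(Mx)` is an algebra automorphism for invertible `M`** (inverse `M⁻¹`, "as we compose
with invertible linear maps"). [cite: MediniShpilka2021, §1.1.6 (arXiv p0007:L7-L18)] -/
theorem exists_algEquiv_linSubst (M : Matrix σ σ K) (hM : IsUnit M.det) :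
    ∃ e : MvPolynomial σ K ≃ₐ[K] MvPolynomial σ K,
      ∀ p, e p = aeval (fun v : σ => ∑ w, C (M v w) * X w) p := by
  have h1 : (aeval (fun v : σ => ∑ w, C (M v w) * X w) : MvPolynomial σ K →ₐ[K] _).comp
      (aeval fun v : σ => ∑ w, C (M⁻¹ v w) * X w) = AlgHom.id K _ := by
    rw [aeval_linSubst_comp, Matrix.nonsing_inv_mul M hM, aeval_linSubst_one]
  have h2 : (aeval (fun v : σ => ∑ w, C (M⁻¹ v w) * X w) : MvPolynomial σ K →ₐ[K] _).comp
      (aeval fun v : σ => ∑ w, C (M v w) * X w) = AlgHom.id K _ := by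
    rw [aeval_linSubst_comp, Matrix.mul_nonsing_inv M hM, aeval_linSubst_one]
  exact ⟨AlgEquiv.ofAlgHom _ _ h1 h2, fun p => rfl⟩

/-- Irreducibility is invariant under `q ↦ q(Mx)`, `M` invertible.
[cite: MediniShpilka2021, proof of Lemma 5.12 (arXiv p0028:L15: "`(∂g/∂x_i)(A⁻¹x)` … is therefore irreducible")] -/
theorem irreducible_aeval_linSubst_iff (M : Matrix σ σ K) (hM : IsUnit M.det)
    (p : MvPolynomial σ K) :
    Irreducible (aeval (fun v : σ => ∑ w, C (M v w) * X w) p) ↔ Irreducible p := by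
  obtain ⟨e, he⟩ := exists_algEquiv_linSubst M hM
  rw [← he]
  exact MulEquiv.irreducible_iff e

omit [DecidableEq σ] in
/-- The substituted forms are homogeneous of degree `1`, so `q ↦ q(Mx)` preserves homogeneity.
[cite: MediniShpilka2021, Obs 2.1 (arXiv p0014:L27)] -/
theorem isHomogeneous_aeval_linSubst (M : Matrix σ σ K) {p : MvPolynomial σ K} {n : ℕ}
    (hp : p.IsHomogeneous n) :
    (aeval (fun v : σ => ∑ w, C (M v w) * X w) p).IsHomogeneous n := by
  have := hp.aeval (fun v : σ => ∑ w, C (M v w) * X w)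
    (fun v => IsHomogeneous.sum _ _ _ fun w _ => isHomogeneous_C_mul_X _ _)
  rwa [one_mul] at this

/-- A column of an invertible matrix is nonzero. [cite: MediniShpilka2021, proof of Lemma 5.12 (arXiv p0028:L7-L40), book-keeping] -/
theorem col_ne_zero_of_isUnit_det {M : Matrix σ σ K} (hM : IsUnit M.det) (y : σ) :
    (fun v => M v y) ≠ 0 := by
  intro h
  have h0 : M.det = 0 := Matrix.det_eq_zero_of_column_eq_zero y fun v => congrFun h v
  exact not_isUnit_zero (h0 ▸ hM)

/-- Variables of `q(Mx)`: a variable `y` of `q(Mx)` has `M v y ≠ 0` for some variable `v` of `q`.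
[cite: MediniShpilka2021, proof of Lemma 5.12 (arXiv p0028:L7-L40), book-keeping] -/
theorem exists_ne_zero_of_mem_vars_aeval_linSubst (M : Matrix σ σ K) (q : MvPolynomial σ K)
    {y : σ} (hy : y ∈ (aeval (fun v : σ => ∑ w, C (M v w) * X w) q).vars) :
    ∃ v ∈ q.vars, M v y ≠ 0 := by
  rw [aeval_eq_bind₁] at hy
  obtain ⟨v, hv, hy⟩ := Finset.mem_biUnion.1 (vars_bind₁ _ _ hy)
  refine ⟨v, hv, fun h0 => ?_⟩
  obtain ⟨w, -, hw⟩ := Finset.mem_biUnion.1 (vars_sum_subset _ _ hy)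
  rcases Finset.mem_union.1 (vars_mul _ _ hw) with h | h
  · rw [vars_C] at h
    exact Finset.notMem_empty _ h
  · by_cases hwy : w = y
    · subst hwy
      rw [h0, C_0, zero_mul, vars_0] at hw
      exact Finset.notMem_empty _ hw
    · rw [vars_X, Finset.mem_singleton] at h
      exact hwy h.symm

end LinSubst

/-! ### Monomials of the block polynomial `B = A⁽⁰⁾A⁽¹⁾ + A⁽²⁾A⁽³⁾` -/

section Block

variable {K : Type*} [Field K] {τ : Type*}

/-- Values of a two-block monomial. [cite: MediniShpilka2021, proof of Lemma 5.12 (arXiv p0028:L7-L40), book-keeping] -/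
theorem mapDomain_mk_add_apply {b₀ b₁ : Fin 4} (hb : b₀ ≠ b₁) (μ ν : τ →₀ ℕ) (b : Fin 4) (j : τ) :
    (Finsupp.mapDomain (Prod.mk b₀) μ + Finsupp.mapDomain (Prod.mk b₁) ν) (b, j) =
      (if b = b₀ then μ j else 0) + (if b = b₁ then ν j else 0) := by
  rw [Finsupp.add_apply]
  congr 1
  · by_cases h : b = b₀
    · subst h
      rw [if_pos rfl, Finsupp.mapDomain_apply (Prod.mk_right_injective b) μ j]
    · rw [if_neg h, Finsupp.mapDomain_notin_range]
      rintro ⟨j', hj'⟩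
      exact h (Prod.mk.inj hj').1.symm
  · by_cases h : b = b₁
    · subst h
      rw [if_pos rfl, Finsupp.mapDomain_apply (Prod.mk_right_injective b) ν j]
    · rw [if_neg h, Finsupp.mapDomain_notin_range]
      rintro ⟨j', hj'⟩
      exact h (Prod.mk.inj hj').1.symm

/-- Monomials of a product of two block copies `A⁽ᵇ⁾·A⁽ᵇ'⁾`. [cite: MediniShpilka2021, Obs 5.7 / obs:monRoanf (arXiv p0025:L57-L60)] -/
theorem exists_decomp_of_mem_support_rename_mul [DecidableEq τ] (A : MvPolynomial τ K) (b b' : Fin 4)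
    {m : Fin 4 × τ →₀ ℕ} (hm : m ∈ (rename (Prod.mk b) A * rename (Prod.mk b') A).support) :
    ∃ μ ∈ A.support, ∃ ν ∈ A.support,
      m = Finsupp.mapDomain (Prod.mk b) μ + Finsupp.mapDomain (Prod.mk b') ν := by
  obtain ⟨a, ha, c, hc, hac⟩ := Finset.mem_add.1 (support_mul _ _ hm)
  rw [support_rename_of_injective (Prod.mk_right_injective _), Finset.mem_image] at ha hc
  obtain ⟨μ, hμ, rfl⟩ := ha
  obtain ⟨ν, hν, rfl⟩ := hc
  exact ⟨μ, hμ, ν, hν, hac.symm⟩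

/-- **Monomials of `B = A⁽⁰⁾A⁽¹⁾ + A⁽²⁾A⁽³⁾`**: each is the union of a monomial of `A` placed in block
`b₀` and one placed in the sibling block `1 - b₀`, `b₀ ∈ {0, 2}`.
[cite: MediniShpilka2021, Obs 5.7, obs:monRoanf (arXiv p0025:L57-L60, p0026)] -/
theorem exists_decomp_of_mem_support_block [DecidableEq τ] (A : MvPolynomial τ K) {m : Fin 4 × τ →₀ ℕ}
    (hm : m ∈ (rename (Prod.mk (0 : Fin 4)) A * rename (Prod.mk (1 : Fin 4)) A +
      rename (Prod.mk (2 : Fin 4)) A * rename (Prod.mk (3 : Fin 4)) A).support) :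
    ∃ b₀ : Fin 4, (b₀ = 0 ∨ b₀ = 2) ∧ ∃ μ ∈ A.support, ∃ ν ∈ A.support,
      m = Finsupp.mapDomain (Prod.mk b₀) μ + Finsupp.mapDomain (Prod.mk (1 - b₀)) ν := by
  rcases Finset.mem_union.1 (support_add hm) with h | h
  · obtain ⟨μ, hμ, ν, hν, rfl⟩ := exists_decomp_of_mem_support_rename_mul A 0 1 h
    exact ⟨0, Or.inl rfl, μ, hμ, ν, hν, by rw [sub_zero]⟩
  · obtain ⟨μ, hμ, ν, hν, rfl⟩ := exists_decomp_of_mem_support_rename_mul A 2 3 h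
    exact ⟨2, Or.inr rfl, μ, hμ, ν, hν, by rw [show (1 : Fin 4) - 2 = 3 from by decide]⟩

/-- Symmetric form: a monomial of `B` with a variable in block `s` is an `A`-monomial in block `s`
plus an `A`-monomial in block `1 - s`. [cite: MediniShpilka2021, Obs 5.7, obs:monRoanf (arXiv p0025:L57-L60)] -/
theorem exists_decomp_of_mem_support_block_of_ne_zero [DecidableEq τ] (A : MvPolynomial τ K)
    {m : Fin 4 × τ →₀ ℕ}
    (hm : m ∈ (rename (Prod.mk (0 : Fin 4)) A * rename (Prod.mk (1 : Fin 4)) A +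
      rename (Prod.mk (2 : Fin 4)) A * rename (Prod.mk (3 : Fin 4)) A).support)
    {s : Fin 4} {j₀ : τ} (hj₀ : m (s, j₀) ≠ 0) :
    ∃ μ ∈ A.support, ∃ ν ∈ A.support,
      m = Finsupp.mapDomain (Prod.mk s) μ + Finsupp.mapDomain (Prod.mk (1 - s)) ν := by
  obtain ⟨b₀, -, μ, hμ, ν, hν, rfl⟩ := exists_decomp_of_mem_support_block A hm
  rw [mapDomain_mk_add_apply (one_sub_ne_self b₀).symm] at hj₀
  by_cases h1 : s = b₀
  · subst h1
    exact ⟨μ, hμ, ν, hν, rfl⟩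
  · by_cases h2 : s = 1 - b₀
    · subst h2
      refine ⟨ν, hν, μ, hμ, ?_⟩
      rw [sub_sub_cancel, add_comm]
    · rw [if_neg h1, if_neg h2, add_zero] at hj₀
      exact absurd rfl hj₀

/-- The monomials of `B` are multilinear when `A` is. [cite: MediniShpilka2021, Obs 5.5 (multilinearity of ROPs)] -/
theorem block_support_le_one [DecidableEq τ] (A : MvPolynomial τ K) (hA1 : ∀ j, degreeOf j A ≤ 1)
    {m : Fin 4 × τ →₀ ℕ}
    (hm : m ∈ (rename (Prod.mk (0 : Fin 4)) A * rename (Prod.mk (1 : Fin 4)) A +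
      rename (Prod.mk (2 : Fin 4)) A * rename (Prod.mk (3 : Fin 4)) A).support) (v : Fin 4 × τ) : m v ≤ 1 := by
  obtain ⟨b₀, -, μ, hμ, ν, hν, rfl⟩ := exists_decomp_of_mem_support_block A hm
  obtain ⟨b, j⟩ := v
  rw [mapDomain_mk_add_apply (one_sub_ne_self b₀).symm]
  have h1 := (monomial_le_degreeOf j hμ).trans (hA1 j)
  have h2 := (monomial_le_degreeOf j hν).trans (hA1 j)
  by_cases hb : b = b₀
  · subst hb
    rw [if_pos rfl, if_neg (one_sub_ne_self b).symm, add_zero]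
    exact h1
  · rw [if_neg hb, zero_add]
    split_ifs
    · exact h2
    · exact zero_le_one

/-- Variables of a block copy `A⁽ᵇ⁾` lie in block `b`. [cite: MediniShpilka2021, proof of Lemma 5.12 (arXiv p0028:L7-L40), book-keeping] -/
theorem fst_eq_of_mem_vars_rename [DecidableEq τ] (A : MvPolynomial τ K) (b : Fin 4) {v : Fin 4 × τ}
    (hv : v ∈ (rename (Prod.mk b) A).vars) : v.1 = b := by
  obtain ⟨j, -, rfl⟩ := Finset.mem_image.1 (vars_rename _ _ hv)
  rfl

/-- Variables of `A⁽ᵇ⁾·A⁽ᵇ'⁾` lie in blocks `b, b'`. [cite: MediniShpilka2021, proof of Lemma 5.12 (arXiv p0028:L7-L40), book-keeping] -/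
theorem fst_eq_or_of_mem_vars_rename_mul [DecidableEq τ] (A : MvPolynomial τ K) (b b' : Fin 4) {v : Fin 4 × τ}
    (hv : v ∈ (rename (Prod.mk b) A * rename (Prod.mk b') A).vars) : v.1 = b ∨ v.1 = b' := by
  rcases Finset.mem_union.1 (vars_mul _ _ hv) with h | h
  · exact Or.inl (fst_eq_of_mem_vars_rename A b h)
  · exact Or.inr (fst_eq_of_mem_vars_rename A b' h)

/-- `B` is homogeneous of degree `2d` when `A` is homogeneous of degree `d`.
[cite: MediniShpilka2021, Def 8 (ANF_Δ is `2^Δ`-homogeneous)] -/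
theorem isHomogeneous_block (A : MvPolynomial τ K) {d : ℕ} (hAd : A.IsHomogeneous d) :
    (rename (Prod.mk (0 : Fin 4)) A * rename (Prod.mk (1 : Fin 4)) A +
      rename (Prod.mk (2 : Fin 4)) A * rename (Prod.mk (3 : Fin 4)) A).IsHomogeneous (d + d) :=
  ((hAd.rename_isHomogeneous).mul hAd.rename_isHomogeneous).add
    ((hAd.rename_isHomogeneous).mul hAd.rename_isHomogeneous)

/-- **Splitting a first-order operator along the top addition gate**:
`Σ_v u_v ∂_v B = Σ_v u⁰¹_v ∂_v (A⁽⁰⁾A⁽¹⁾) + Σ_v u²³_v ∂_v (A⁽²⁾A⁽³⁾)` where `u⁰¹` keeps the entries of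
blocks `0, 1` and `u²³` those of blocks `2, 3`.
[cite: MediniShpilka2021, proof of Lemma 5.12 (arXiv p0028:L13-L16)] -/
theorem sum_C_mul_pderiv_block_split [Fintype τ] [DecidableEq τ] (A : MvPolynomial τ K) (u : Fin 4 × τ → K) :
    (∑ v, C (u v) * pderiv v (rename (Prod.mk (0 : Fin 4)) A * rename (Prod.mk (1 : Fin 4)) A +
      rename (Prod.mk (2 : Fin 4)) A * rename (Prod.mk (3 : Fin 4)) A)) =
      (∑ v, C (if (v.1 : ℕ) < 2 then u v else 0) *
          pderiv v (rename (Prod.mk (0 : Fin 4)) A * rename (Prod.mk (1 : Fin 4)) A)) +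
        ∑ v, C (if (v.1 : ℕ) < 2 then 0 else u v) *
          pderiv v (rename (Prod.mk (2 : Fin 4)) A * rename (Prod.mk (3 : Fin 4)) A) := by
  rw [← Finset.sum_add_distrib]
  refine Finset.sum_congr rfl fun v _ => ?_
  rw [map_add, mul_add]
  congr 1
  · split_ifs with h
    · rfl
    · rw [pderiv_eq_zero_of_notMem_vars, mul_zero, mul_zero]
      intro hv
      rcases fst_eq_or_of_mem_vars_rename_mul A 0 1 hv with h' | h' <;>
        (rw [h'] at h; exact h (by decide))
  · split_ifs with h
    · rw [pderiv_eq_zero_of_notMem_vars, mul_zero, C_0, zero_mul]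
      intro hv
      rcases fst_eq_or_of_mem_vars_rename_mul A 2 3 hv with h' | h' <;>
        (rw [h'] at h; revert h; decide)
    · rfl

/-- The low part of the split only sees `A⁽⁰⁾A⁽¹⁾`: `Σ_v u⁰¹_v ∂_v(A⁽⁰⁾A⁽¹⁾) = Σ_v u_v ∂_v(A⁽⁰⁾A⁽¹⁾)`.
[cite: MediniShpilka2021, proof of Lemma 5.12 (arXiv p0028:L13-L16)] -/
theorem sum_C_ite_mul_pderiv_low [Fintype τ] [DecidableEq τ] (A : MvPolynomial τ K) (u : Fin 4 × τ → K) :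
    (∑ v, C (if (v.1 : ℕ) < 2 then u v else 0) *
        pderiv v (rename (Prod.mk (0 : Fin 4)) A * rename (Prod.mk (1 : Fin 4)) A)) =
      ∑ v, C (u v) * pderiv v (rename (Prod.mk (0 : Fin 4)) A * rename (Prod.mk (1 : Fin 4)) A) := by
  refine Finset.sum_congr rfl fun v _ => ?_
  split_ifs with h
  · rfl
  · rw [pderiv_eq_zero_of_notMem_vars, mul_zero, mul_zero]
    intro hv
    rcases fst_eq_or_of_mem_vars_rename_mul A 0 1 hv with h' | h' <;>
      (rw [h'] at h; exact h (by decide))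

/-- The high part of the split only sees `A⁽²⁾A⁽³⁾`. [cite: MediniShpilka2021, proof of Lemma 5.12 (arXiv p0028:L13-L16)] -/
theorem sum_C_ite_mul_pderiv_high [Fintype τ] [DecidableEq τ] (A : MvPolynomial τ K) (u : Fin 4 × τ → K) :
    (∑ v, C (if (v.1 : ℕ) < 2 then 0 else u v) *
        pderiv v (rename (Prod.mk (2 : Fin 4)) A * rename (Prod.mk (3 : Fin 4)) A)) =
      ∑ v, C (u v) * pderiv v (rename (Prod.mk (2 : Fin 4)) A * rename (Prod.mk (3 : Fin 4)) A) := by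
  refine Finset.sum_congr rfl fun v _ => ?_
  split_ifs with h
  · rw [pderiv_eq_zero_of_notMem_vars, mul_zero, mul_zero]
    intro hv
    rcases fst_eq_or_of_mem_vars_rename_mul A 2 3 hv with h' | h' <;>
      (rw [h'] at h; revert h; decide)
  · rfl

end Block

/-! ### First dichotomy: every column of `M` lives on one side of the top addition gate -/

section Columns

variable {K : Type*} [Field K] {τ : Type*} [Fintype τ] [DecidableEq τ]

omit [Fintype τ] in
/-- **Sibling divisibility** ("every monomial of `∂g/∂x_i` is divisible by `x_j`", `x_j` the sibling):
if the monomials of `g` are monomials of `B` and `A` has the sibling property, then for every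
variable `(b, j)` there is `j' ≠ j` with `∂g/∂x_{(b,j)} = x_{(b,j')} · R`.
[cite: MediniShpilka2021, Obs 5.7 and proof of Lemma 5.12 (arXiv p0025:L50-L53, p0028:L16-L18)] -/
theorem exists_pderiv_eq_X_mul (A : MvPolynomial τ K)
    (hAsib : ∀ j : τ, ∃ j' : τ, j' ≠ j ∧ ∀ μ ∈ A.support, μ j ≠ 0 → μ j' ≠ 0)
    {g : MvPolynomial (Fin 4 × τ) K}
    (hg : g.support ⊆ (rename (Prod.mk (0 : Fin 4)) A * rename (Prod.mk (1 : Fin 4)) A +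
      rename (Prod.mk (2 : Fin 4)) A * rename (Prod.mk (3 : Fin 4)) A).support) (b : Fin 4) (j : τ) :
    ∃ j' : τ, j' ≠ j ∧ ∃ R : MvPolynomial (Fin 4 × τ) K, pderiv (b, j) g = X (b, j') * R := by
  obtain ⟨j', hj', hsib⟩ := hAsib j
  refine ⟨j', hj', (pderiv (b, j) g).divMonomial (Finsupp.single (b, j') 1),
    (X_mul_divMonomial_eq_self _ _ fun β hβ => ?_).symm⟩
  obtain ⟨α, hα, rfl⟩ := Finset.mem_image.1 (support_pderiv_subset g (b, j) hβ)
  obtain ⟨hαg, hαj⟩ := Finset.mem_filter.1 hα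
  have hne : ((b, j') : Fin 4 × τ) ≠ (b, j) := fun h => hj' (Prod.mk.inj h).2
  rw [Finsupp.coe_tsub, Pi.sub_apply, Finsupp.single_eq_of_ne hne, tsub_zero]
  -- `α` is a monomial of `B` containing `(b, j)`, hence containing the sibling `(b, j')`
  obtain ⟨μ, hμ, ν, hν, hdec⟩ :=
    exists_decomp_of_mem_support_block_of_ne_zero A (hg hαg) hαj
  rw [hdec, mapDomain_mk_add_apply (one_sub_ne_self b).symm, if_pos rfl,
    if_neg (one_sub_ne_self b).symm, add_zero] at hαj ⊢
  exact hsib μ hμ hαj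

/-- **First dichotomy** (columns of `M`). If `mon(B(Mx)) ⊆ mon(B)` then every column `y` of `M`
vanishes on the rows of blocks `2, 3` or on the rows of blocks `0, 1`: otherwise `∂(B(Mx))/∂x_y` is
the image under `q ↦ q(Mx)` of a sum of two non-constant variable-disjoint multilinear polynomials,
hence irreducible (Obs. 2.7), while it is `x_{y'} · R` with `deg R ≥ 2`.
[cite: MediniShpilka2021, proof of Lemma 5.12 (arXiv p0028:L13-L19)] -/
theorem col_low_or_high (A : MvPolynomial τ K) {d : ℕ} (hAd : A.IsHomogeneous d) (hd : 2 ≤ d)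
    (hA1 : ∀ j, degreeOf j A ≤ 1)
    (hAsib : ∀ j : τ, ∃ j' : τ, j' ≠ j ∧ ∀ μ ∈ A.support, μ j ≠ 0 → μ j' ≠ 0)
    (hBind : ∀ u : Fin 4 × τ → K, u ≠ 0 →
      (∑ v, C (u v) * pderiv v (rename (Prod.mk (0 : Fin 4)) A * rename (Prod.mk (1 : Fin 4)) A +
        rename (Prod.mk (2 : Fin 4)) A * rename (Prod.mk (3 : Fin 4)) A)) ≠ 0)
    (M : Matrix (Fin 4 × τ) (Fin 4 × τ) K) (hM : IsUnit M.det)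
    (hsupp : (aeval (fun v : Fin 4 × τ => ∑ w, C (M v w) * X w)
        (rename (Prod.mk (0 : Fin 4)) A * rename (Prod.mk (1 : Fin 4)) A +
          rename (Prod.mk (2 : Fin 4)) A * rename (Prod.mk (3 : Fin 4)) A)).support ⊆
      (rename (Prod.mk (0 : Fin 4)) A * rename (Prod.mk (1 : Fin 4)) A +
        rename (Prod.mk (2 : Fin 4)) A * rename (Prod.mk (3 : Fin 4)) A).support)
    (y : Fin 4 × τ) :
    (∀ v : Fin 4 × τ, ¬ (v.1 : ℕ) < 2 → M v y = 0) ∨ (∀ v : Fin 4 × τ, (v.1 : ℕ) < 2 → M v y = 0) := by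
  set B := rename (Prod.mk (0 : Fin 4)) A * rename (Prod.mk (1 : Fin 4)) A +
    rename (Prod.mk (2 : Fin 4)) A * rename (Prod.mk (3 : Fin 4)) A with hB
  set g := aeval (fun v : Fin 4 × τ => ∑ w, C (M v w) * X w) B with hgdef
  by_contra hcon
  rw [not_or] at hcon
  obtain ⟨hhigh, hlow⟩ := hcon
  push Not at hhigh hlow
  -- the two halves of the operator `Σ_v M_{v,y} ∂_v`
  set u : Fin 4 × τ → K := fun v => M v y with hu
  set uL : Fin 4 × τ → K := fun v => if (v.1 : ℕ) < 2 then u v else 0 with huL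
  set uH : Fin 4 × τ → K := fun v => if (v.1 : ℕ) < 2 then 0 else u v with huH
  set P := rename (Prod.mk (0 : Fin 4)) A * rename (Prod.mk (1 : Fin 4)) A with hP
  set Q := rename (Prod.mk (2 : Fin 4)) A * rename (Prod.mk (3 : Fin 4)) A with hQ
  have hBPQ : B = P + Q := rfl
  set DL := ∑ v, C (uL v) * pderiv v P with hDL
  set DH := ∑ v, C (uH v) * pderiv v Q with hDH
  have hsplit : (∑ v, C (u v) * pderiv v B) = DL + DH := sum_C_mul_pderiv_block_split A u
  -- `DL`, `DH` as operators on `B`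
  have hlowQ : ∀ v : Fin 4 × τ, (v.1 : ℕ) < 2 → pderiv v Q = 0 := by
    intro v hv
    apply pderiv_eq_zero_of_notMem_vars
    intro hvQ
    rcases fst_eq_or_of_mem_vars_rename_mul A 2 3 hvQ with h' | h' <;>
      (rw [h'] at hv; revert hv; decide)
  have hhighP : ∀ v : Fin 4 × τ, ¬ (v.1 : ℕ) < 2 → pderiv v P = 0 := by
    intro v hv
    apply pderiv_eq_zero_of_notMem_vars
    intro hvP
    rcases fst_eq_or_of_mem_vars_rename_mul A 0 1 hvP with h' | h' <;>
      (rw [h'] at hv; exact hv (by decide))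
  have hDL' : DL = ∑ v, C (uL v) * pderiv v B := by
    rw [hBPQ]
    simp_rw [map_add, mul_add]
    rw [Finset.sum_add_distrib]
    have h0 : (∑ v, C (uL v) * pderiv v Q) = 0 := Finset.sum_eq_zero fun v _ => by
      by_cases hv : (v.1 : ℕ) < 2
      · rw [hlowQ v hv, mul_zero]
      · simp only [huL, if_neg hv, C_0, zero_mul]
    rw [h0, add_zero]
  have hDH' : DH = ∑ v, C (uH v) * pderiv v B := by
    rw [hBPQ]
    simp_rw [map_add, mul_add]
    rw [Finset.sum_add_distrib]
    have h0 : (∑ v, C (uH v) * pderiv v P) = 0 := Finset.sum_eq_zero fun v _ => by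
      by_cases hv : (v.1 : ℕ) < 2
      · simp only [huH, if_pos hv, C_0, zero_mul]
      · rw [hhighP v hv, mul_zero]
    rw [h0, zero_add]
  -- both halves are nonzero
  have huL0 : uL ≠ 0 := by
    obtain ⟨v, hv, hv0⟩ := hlow
    intro h
    have := congrFun h v
    simp only [huL, if_pos hv, Pi.zero_apply] at this
    exact hv0 this
  have huH0 : uH ≠ 0 := by
    obtain ⟨v, hv, hv0⟩ := hhigh
    intro h
    have := congrFun h v
    simp only [huH, if_neg (not_lt.2 hv), Pi.zero_apply] at this
    exact hv0 this
  have hDL0 : DL ≠ 0 := hDL' ▸ hBind uL huL0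
  have hDH0 : DH ≠ 0 := hDH' ▸ hBind uH huH0
  -- multilinear, homogeneous of degree `2d - 1`, variable-disjoint
  have hB1 : ∀ v, degreeOf v B ≤ 1 :=
    degreeOf_le_one_of_support fun m hm v => block_support_le_one A hA1 hm v
  have hBhom : B.IsHomogeneous (d + d) := isHomogeneous_block A hAd
  have hDhom : ∀ w : Fin 4 × τ → K, (∑ v, C (w v) * pderiv v B).IsHomogeneous (d + d - 1) :=
    fun w => IsHomogeneous.sum _ _ _ fun v _ => (hBhom.pderiv).C_mul _
  have hDL1 : ∀ v, degreeOf v DL ≤ 1 := by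
    rw [hDL']; exact degreeOf_sum_C_mul_pderiv_le uL hB1
  have hDH1 : ∀ v, degreeOf v DH ≤ 1 := by
    rw [hDH']; exact degreeOf_sum_C_mul_pderiv_le uH hB1
  have hDLvars : DL.vars ⊆ P.vars := vars_sum_C_mul_pderiv_subset uL P
  have hDHvars : DH.vars ⊆ Q.vars := vars_sum_C_mul_pderiv_subset uH Q
  have hdisj : Disjoint DL.vars DH.vars := by
    rw [Finset.disjoint_left]
    intro v hvL hvH
    rcases fst_eq_or_of_mem_vars_rename_mul A 0 1 (hDLvars hvL) with h | h <;>
      rcases fst_eq_or_of_mem_vars_rename_mul A 2 3 (hDHvars hvH) with h' | h' <;>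
        (rw [h] at h'; revert h'; decide)
  have hd0 : d + d - 1 ≠ 0 := by omega
  have hDLne : DL.vars.Nonempty := vars_nonempty_of_isHomogeneous (hDL' ▸ hDhom uL) hd0 hDL0
  have hDHne : DH.vars.Nonempty := vars_nonempty_of_isHomogeneous (hDH' ▸ hDhom uH) hd0 hDH0
  -- irreducibility of `Σ_v M_{v,y} ∂_v B`, hence of `∂g/∂x_y`
  have hirr : Irreducible (∑ v, C (u v) * pderiv v B) := by
    have := irreducible_add_add_C_of_multilinear_of_disjoint_vars hDL1 hDH1 hdisj hDLne hDHne 0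
    rwa [C_0, add_zero, ← hsplit] at this
  have hder : pderiv y g = aeval (fun v : Fin 4 × τ => ∑ w, C (M v w) * X w)
      (∑ v, C (u v) * pderiv v B) := pderiv_aeval_linSubst (fun v w => M v w) y B
  have hirr' : Irreducible (pderiv y g) := by
    rw [hder, irreducible_aeval_linSubst_iff M hM]
    exact hirr
  -- but `∂g/∂x_y = x_{y'} · R` with `R` of degree `≥ 2`
  obtain ⟨j', -, R, hR⟩ := exists_pderiv_eq_X_mul A hAsib hsupp y.1 y.2
  have hy : ((y.1, y.2) : Fin 4 × τ) = y := rfl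
  rw [hy] at hR
  rw [hR] at hirr'
  rcases hirr'.isUnit_or_isUnit rfl with hX | hRu
  · obtain ⟨r, -, hr⟩ := isUnit_iff_eq_C_of_isReduced.1 hX
    have := congrArg (coeff (Finsupp.single (y.1, j') 1)) hr
    rw [coeff_X, if_pos rfl, coeff_C, if_neg (Finsupp.single_ne_zero.2 one_ne_zero).symm] at this
    exact one_ne_zero this
  · obtain ⟨r, -, hr⟩ := isUnit_iff_eq_C_of_isReduced.1 hRu
    -- `pderiv y g` is nonzero and all its monomials have degree `2d - 1 ≥ 3`
    have hne : pderiv y g ≠ 0 := by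
      rw [hder]
      intro h0
      have hinj := aeval_linSubst_injective M hM
      rw [← map_zero (aeval (fun v : Fin 4 × τ => ∑ w, C (M v w) * X w) :
        MvPolynomial (Fin 4 × τ) K →ₐ[K] MvPolynomial (Fin 4 × τ) K)] at h0
      exact hBind u (col_ne_zero_of_isUnit_det hM y) (hinj h0)
    obtain ⟨β, hβ⟩ := exists_coeff_ne_zero hne
    have hβsupp : β ∈ (pderiv y g).support := mem_support_iff.2 hβ
    obtain ⟨α, hα, rfl⟩ := Finset.mem_image.1 (support_pderiv_subset g y hβsupp)
    obtain ⟨hαg, hαy⟩ := Finset.mem_filter.1 hα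
    have hdegα : (α : Fin 4 × τ →₀ ℕ).degree = d + d := by
      by_contra h
      exact (mem_support_iff.1 (hsupp hαg)) (hBhom.coeff_eq_zero h)
    -- in `X y' * C r` the only monomial is `single y' 1`
    rw [hR, hr, mem_support_iff, mul_comm, coeff_C_mul, coeff_X] at hβsupp
    split_ifs at hβsupp with hs
    · have hdeg := congrArg Finsupp.degree hs
      rw [Finsupp.degree_single] at hdeg
      have h2 : (α - Finsupp.single y 1).degree + 1 = α.degree := by
        have hle : Finsupp.single y 1 ≤ α := by
          rw [Finsupp.single_le_iff]; exact Nat.one_le_iff_ne_zero.2 hαy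
        have := congrArg Finsupp.degree (tsub_add_cancel_of_le hle)
        rwa [map_add, Finsupp.degree_single] at this
      omega
    · simp at hβsupp

end Columns

end MS2021

end Literature.Computability.AlgebraicComplexity

end
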